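import Summits.Ventures.YMGap.FlowData.LinkWeightExpansion
import Summits.Ventures.YMGap.FlowData.LinkCharacterBessel
import Literature.Analysis.OperatorTheory.PositivityImproving

/-!
# Venture YMGap, track Y3 FLOW-DATA — the SU(2) slice's CHARACTER PROJECTIONS and LINK WEIGHT as OPERATORS on `L²`:
# `⟪z, W z⟫ = Σ_ν q_ν ‖P_ν z‖²` (a convergent series) and Bessel `Σ_{ν∈S} ‖P_ν z‖² ≤ ‖z‖²` (theorems only)

HONEST FRAMING: venture file of the cell `pub-ymgap` (QuantumFields programme), track Y3, lineage A (seat flow-eng-1).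
Finite Haar integrals over `SU(2)^ι` (one time slice, any finite link set `ι`); no number, no row, nothing about
limits, the continuum or a mass gap.  NO Peter–Weyl (Bessel's inequality without completeness).

WHY.  The operator-level kept-set tail theorem (`KWeightTailOperator`, files 1–7) leaves ONE tube hypothesis open:
the DROPPED BOUND `⟪z, 𝒦 z⟫ ≤ κ‖z‖²` off the kept nets.  Its abstract frame `KWeightTailOperatorDropped.dropped_bound_of_hasSum`
asks for (i) projections `P_ν` on `L²`, (ii) the kinetic form as a series `⟪z, 𝒦 z⟫ = Σ_ν q_ν ‖P_ν z‖²`, (iii) Bessel.  This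
file supplies (i)–(iii) for the UN-AVERAGED link weight `W` (kernel `Π_e e^{β a₀(b_e a_e⁻¹)}`) of the SU(2) slice, as
`L²` statements about OPERATORS (existence by the tree's `exists_kernelOp`; no definition):

* `exists_charProjOp` — for every multi-index `ν` a bounded `P_ν` with `(P_ν φ)(a) = d_ν ∫ X_ν(a,b) φ(b) db` a.e.
  (the reproducing integral `p_ν` of `LinkCharacterMerging` as an operator); `exists_weightOp` — a bounded `W` with
  `(W φ)(a) = ∫ Π_e e^{β a₀(b_e a_e⁻¹)} φ(b) db` a.e.;
* `norm_sq_charProjOp` — `‖P_ν z‖² = ∫ (p_ν z)²`;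
* **`hasSum_inner_weightOp`** — `HasSum (ν ↦ q_ν ‖P_ν z‖²) ⟪z, W z⟫`, `q_ν = Π_e (I_{ν_e}(β) − I_{ν_e+2}(β))/(ν_e+1)`
  (`β ≥ 0`; p1's bilinear series `integral_mul_integral_weight_mul_eq_tsum` + `integral_charProj_sq` + its absolute
  convergence);
* **`sum_norm_sq_charProjOp_le`** — Bessel: `Σ_{ν ∈ S} ‖P_ν z‖² ≤ ‖z‖²` for every finite `S`
  (`sum_integral_charProj_sq_le`).

WHAT IS NOT HERE: the passage from `W` to the Gauss-law kinetic operator `𝒦 = Π W Π` of `KWeightTailTubeKinetic` (needs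
the gauge-averaging projection `Π` as an operator on `L²`; as forms `𝒦 ≤ W`), and the spanning fact (the engine's nets
exhaust the gauge-invariant part of the kept isotypic components); numbers.

References: I. Montvay, G. Münster (1994) §3.2.6, §3.4.2 [cite: MontvayMunster1994, §3.4.2]; Bessel's inequality [folklore].
-/

noncomputable section

open scoped BigOperators ENNReal RealInnerProductSpace
open MeasureTheory Filter Function Polynomial.Chebyshev
open Literature.MathematicalPhysics.QuantumFieldTheory Literature.Analysis.OperatorTheory
open Literature.MathematicalPhysics.QuantumLattice Literature.Analysis.FunctionSpaces
open Summit.Ventures.LatticeQCDFlow.Exactness Summit.Ventures.LatticeQCDFlow.Scoring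

namespace Summit.Ventures.YMGap.FlowData

namespace KWeightTailOperator

section CharProjOp

variable {ι : Type} [Fintype ι]

/-- Joint continuity of the dressed character kernel `(a,b) ↦ d_ν X_ν(a,b)`. [folklore] -/
theorem continuous_charProjKernel (ν : ι → ℕ) :
    Continuous (uncurry fun (a b : ι → Matrix.specialUnitaryGroup (Fin 2) ℂ) =>
      (∏ e, ((ν e : ℝ) + 1)) * ∏ e, (U ℝ (ν e)).eval (su2a0 (b e * (a e)⁻¹))) :=
  continuous_const.mul (SU2Links.continuous_prod_su2Character_pair ν)

/-- **The character projection `P_ν` as an operator on `L²(SU(2)^ι)`**: a bounded `P_ν` with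
`(P_ν φ)(a) = d_ν ∫ X_ν(a,b) φ(b) db` a.e. (existence; tree `exists_kernelOp`). [folklore] -/
theorem exists_charProjOp (ν : ι → ℕ) :
    ∃ P : Lp ℝ 2 (Measure.pi fun _ : ι => haarProbability (Matrix.specialUnitaryGroup (Fin 2) ℂ)) →L[ℝ]
        Lp ℝ 2 (Measure.pi fun _ : ι => haarProbability (Matrix.specialUnitaryGroup (Fin 2) ℂ)),
      ∀ φ, (P φ : (ι → Matrix.specialUnitaryGroup (Fin 2) ℂ) → ℝ)
        =ᵐ[Measure.pi fun _ : ι => haarProbability (Matrix.specialUnitaryGroup (Fin 2) ℂ)]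
        fun a => (∏ e, ((ν e : ℝ) + 1)) * ∫ b, (∏ e, (U ℝ (ν e)).eval (su2a0 (b e * (a e)⁻¹))) * φ b
          ∂(Measure.pi fun _ : ι => haarProbability (Matrix.specialUnitaryGroup (Fin 2) ℂ)) := by
  have hC : ∀ a b : ι → Matrix.specialUnitaryGroup (Fin 2) ℂ,
      ‖(∏ e, ((ν e : ℝ) + 1)) * ∏ e, (U ℝ (ν e)).eval (su2a0 (b e * (a e)⁻¹))‖ ≤
        (∏ e, ((ν e : ℝ) + 1)) * ∏ e, ((ν e : ℝ) + 1) := fun a b => by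
    rw [norm_mul, Real.norm_eq_abs, Real.norm_eq_abs, abs_of_pos (SU2Links.prod_succ_pos ν)]
    exact mul_le_mul_of_nonneg_left (SU2Links.abs_prod_su2Character_le ν _) (SU2Links.prod_succ_pos ν).le
  obtain ⟨P, hP⟩ := exists_kernelOp (μ := Measure.pi fun _ : ι => haarProbability (Matrix.specialUnitaryGroup (Fin 2) ℂ))
    (continuous_charProjKernel ν).stronglyMeasurable hC
  refine ⟨P, fun φ => ?_⟩
  filter_upwards [hP φ] with a ha
  rw [ha, ← integral_const_mul]
  refine integral_congr_ae (Eventually.of_forall fun b => ?_)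
  simp only
  ring

/-- Joint continuity of the link weight kernel `(a,b) ↦ Π_e e^{β a₀(b_e a_e⁻¹)}`. [folklore] -/
theorem continuous_weightKernel (β : ℝ) :
    Continuous (uncurry fun (a b : ι → Matrix.specialUnitaryGroup (Fin 2) ℂ) =>
      ∏ e, Real.exp (β * su2a0 (b e * (a e)⁻¹))) :=
  continuous_finsetProd _ fun e _ => Real.continuous_exp.comp (continuous_const.mul
    (continuous_su2a0.comp (((continuous_apply e).comp continuous_snd).mul
      ((continuous_apply e).comp continuous_fst).inv)))

/-- **The un-averaged link weight `W` as an operator on `L²(SU(2)^ι)`**: a bounded `W` with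
`(W φ)(a) = ∫ Π_e e^{β a₀(b_e a_e⁻¹)} φ(b) db` a.e. (existence; tree `exists_kernelOp`). [folklore] -/
theorem exists_weightOp (β : ℝ) :
    ∃ W : Lp ℝ 2 (Measure.pi fun _ : ι => haarProbability (Matrix.specialUnitaryGroup (Fin 2) ℂ)) →L[ℝ]
        Lp ℝ 2 (Measure.pi fun _ : ι => haarProbability (Matrix.specialUnitaryGroup (Fin 2) ℂ)),
      ∀ φ, (W φ : (ι → Matrix.specialUnitaryGroup (Fin 2) ℂ) → ℝ)
        =ᵐ[Measure.pi fun _ : ι => haarProbability (Matrix.specialUnitaryGroup (Fin 2) ℂ)]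
        fun a => ∫ b, (∏ e, Real.exp (β * su2a0 (b e * (a e)⁻¹))) * φ b
          ∂(Measure.pi fun _ : ι => haarProbability (Matrix.specialUnitaryGroup (Fin 2) ℂ)) := by
  obtain ⟨C, hC⟩ := isCompact_univ.exists_bound_of_continuousOn (continuous_weightKernel (ι := ι) β).continuousOn
  exact exists_kernelOp (μ := Measure.pi fun _ : ι => haarProbability (Matrix.specialUnitaryGroup (Fin 2) ℂ))
    (continuous_weightKernel β).stronglyMeasurable (C := C) fun a b => hC (a, b) (Set.mem_univ _)

/-- **`‖P_ν z‖² = ∫ (p_ν z)²`** for an operator acting a.e. as the reproducing integral. [folklore] -/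
theorem norm_sq_charProjOp (ν : ι → ℕ)
    {P : Lp ℝ 2 (Measure.pi fun _ : ι => haarProbability (Matrix.specialUnitaryGroup (Fin 2) ℂ)) →L[ℝ]
        Lp ℝ 2 (Measure.pi fun _ : ι => haarProbability (Matrix.specialUnitaryGroup (Fin 2) ℂ))}
    (hP : ∀ φ, (P φ : (ι → Matrix.specialUnitaryGroup (Fin 2) ℂ) → ℝ)
        =ᵐ[Measure.pi fun _ : ι => haarProbability (Matrix.specialUnitaryGroup (Fin 2) ℂ)]
        fun a => (∏ e, ((ν e : ℝ) + 1)) * ∫ b, (∏ e, (U ℝ (ν e)).eval (su2a0 (b e * (a e)⁻¹))) * φ b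
          ∂(Measure.pi fun _ : ι => haarProbability (Matrix.specialUnitaryGroup (Fin 2) ℂ)))
    (z : Lp ℝ 2 (Measure.pi fun _ : ι => haarProbability (Matrix.specialUnitaryGroup (Fin 2) ℂ))) :
    ‖P z‖ ^ 2 = ∫ a, ((∏ e, ((ν e : ℝ) + 1)) * ∫ b, (∏ e, (U ℝ (ν e)).eval (su2a0 (b e * (a e)⁻¹))) * z b
        ∂(Measure.pi fun _ : ι => haarProbability (Matrix.specialUnitaryGroup (Fin 2) ℂ))) ^ 2
        ∂(Measure.pi fun _ : ι => haarProbability (Matrix.specialUnitaryGroup (Fin 2) ℂ)) := by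
  rw [← real_inner_self_eq_norm_sq, inner_eq_integral]
  refine integral_congr_ae ?_
  filter_upwards [hP z] with a ha
  rw [ha, sq]

/-- **THE LINK-WEIGHT FORM AS A SERIES over the character projections**: for `β ≥ 0`, any operators `W`, `P_ν`
acting a.e. as the link weight and the reproducing integrals, and every `z ∈ L²`,
`HasSum (ν ↦ q_ν ‖P_ν z‖²) ⟪z, W z⟫` with `q_ν = Π_e (I_{ν_e}(β) − I_{ν_e+2}(β))/(ν_e+1) ≥ 0`
— hypothesis `hform` of `KWeightTailOperatorDropped.dropped_bound_of_hasSum` for `W`. [cite: MontvayMunster1994, §3.4.2] -/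
theorem hasSum_inner_weightOp {β : ℝ} (hβ : 0 ≤ β)
    {W : Lp ℝ 2 (Measure.pi fun _ : ι => haarProbability (Matrix.specialUnitaryGroup (Fin 2) ℂ)) →L[ℝ]
        Lp ℝ 2 (Measure.pi fun _ : ι => haarProbability (Matrix.specialUnitaryGroup (Fin 2) ℂ))}
    (hW : ∀ φ, (W φ : (ι → Matrix.specialUnitaryGroup (Fin 2) ℂ) → ℝ)
        =ᵐ[Measure.pi fun _ : ι => haarProbability (Matrix.specialUnitaryGroup (Fin 2) ℂ)]
        fun a => ∫ b, (∏ e, Real.exp (β * su2a0 (b e * (a e)⁻¹))) * φ b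
          ∂(Measure.pi fun _ : ι => haarProbability (Matrix.specialUnitaryGroup (Fin 2) ℂ)))
    {P : (ι → ℕ) → Lp ℝ 2 (Measure.pi fun _ : ι => haarProbability (Matrix.specialUnitaryGroup (Fin 2) ℂ)) →L[ℝ]
        Lp ℝ 2 (Measure.pi fun _ : ι => haarProbability (Matrix.specialUnitaryGroup (Fin 2) ℂ))}
    (hP : ∀ ν φ, (P ν φ : (ι → Matrix.specialUnitaryGroup (Fin 2) ℂ) → ℝ)
        =ᵐ[Measure.pi fun _ : ι => haarProbability (Matrix.specialUnitaryGroup (Fin 2) ℂ)]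
        fun a => (∏ e, ((ν e : ℝ) + 1)) * ∫ b, (∏ e, (U ℝ (ν e)).eval (su2a0 (b e * (a e)⁻¹))) * φ b
          ∂(Measure.pi fun _ : ι => haarProbability (Matrix.specialUnitaryGroup (Fin 2) ℂ)))
    (z : Lp ℝ 2 (Measure.pi fun _ : ι => haarProbability (Matrix.specialUnitaryGroup (Fin 2) ℂ))) :
    HasSum (fun ν : ι → ℕ => (∏ e, (besselI (ν e) β - besselI (ν e + 2) β) / ((ν e : ℝ) + 1)) * ‖P ν z‖ ^ 2)
      ⟪z, W z⟫ := by
  have hz : Integrable (z : (ι → Matrix.specialUnitaryGroup (Fin 2) ℂ) → ℝ)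
      (Measure.pi fun _ : ι => haarProbability (Matrix.specialUnitaryGroup (Fin 2) ℂ)) := (Lp.memLp z).integrable one_le_two
  -- the terms, rewritten through `‖P_ν z‖² = ∫ (p_ν z)² = ∫ z · p_ν z`
  have hterm : ∀ ν : ι → ℕ,
      (∏ e, (besselI (ν e) β - besselI (ν e + 2) β) / ((ν e : ℝ) + 1)) * ‖P ν z‖ ^ 2 =
        (∏ e, (besselI (ν e) β - besselI (ν e + 2) β) / ((ν e : ℝ) + 1)) *
          ∫ a, z a * ((∏ e, ((ν e : ℝ) + 1)) * ∫ b, (∏ e, (U ℝ (ν e)).eval (su2a0 (b e * (a e)⁻¹))) * z b ∂(Measure.pi fun _ : ι => haarProbability (Matrix.specialUnitaryGroup (Fin 2) ℂ)))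
            ∂(Measure.pi fun _ : ι => haarProbability (Matrix.specialUnitaryGroup (Fin 2) ℂ)) := by
    intro ν
    rw [norm_sq_charProjOp ν (hP ν) z, SU2Links.integral_charProj_sq ν hz]
  -- the series of p1 for `ψ = h = z`
  have hsum := SU2Links.integral_mul_integral_weight_mul_eq_tsum (ι := ι) hβ hz hz
  have habs := SU2Links.summable_abs_coeff_mul_integral_mul_charProj (ι := ι) hβ hz hz
  have hs : Summable fun ν : ι → ℕ => (∏ e, (besselI (ν e) β - besselI (ν e + 2) β) / ((ν e : ℝ) + 1)) *
      ∫ a, z a * ((∏ e, ((ν e : ℝ) + 1)) * ∫ b, (∏ e, (U ℝ (ν e)).eval (su2a0 (b e * (a e)⁻¹))) * z b ∂(Measure.pi fun _ : ι => haarProbability (Matrix.specialUnitaryGroup (Fin 2) ℂ))) ∂(Measure.pi fun _ : ι => haarProbability (Matrix.specialUnitaryGroup (Fin 2) ℂ)) :=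
    Summable.of_abs habs
  -- `⟪z, W z⟫` is the double integral
  have hinner : ⟪z, W z⟫ = ∫ a, z a * ∫ b, (∏ e, Real.exp (β * su2a0 (b e * (a e)⁻¹))) * z b
      ∂(Measure.pi fun _ : ι => haarProbability (Matrix.specialUnitaryGroup (Fin 2) ℂ)) ∂(Measure.pi fun _ : ι => haarProbability (Matrix.specialUnitaryGroup (Fin 2) ℂ)) :=
    inner_kernelOp_eq_integral hW z z
  simp_rw [hterm]
  rw [hinner, hsum]
  exact hs.hasSum

/-- **BESSEL'S INEQUALITY for the character projections as operators**: `Σ_{ν ∈ S} ‖P_ν z‖² ≤ ‖z‖²` for every finite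
set `S` of multi-indices (no completeness used) — hypothesis `hBessel` of
`KWeightTailOperatorDropped.dropped_bound_of_hasSum`. [folklore] -/
theorem sum_norm_sq_charProjOp_le
    {P : (ι → ℕ) → Lp ℝ 2 (Measure.pi fun _ : ι => haarProbability (Matrix.specialUnitaryGroup (Fin 2) ℂ)) →L[ℝ]
        Lp ℝ 2 (Measure.pi fun _ : ι => haarProbability (Matrix.specialUnitaryGroup (Fin 2) ℂ))}
    (hP : ∀ ν φ, (P ν φ : (ι → Matrix.specialUnitaryGroup (Fin 2) ℂ) → ℝ)
        =ᵐ[Measure.pi fun _ : ι => haarProbability (Matrix.specialUnitaryGroup (Fin 2) ℂ)]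
        fun a => (∏ e, ((ν e : ℝ) + 1)) * ∫ b, (∏ e, (U ℝ (ν e)).eval (su2a0 (b e * (a e)⁻¹))) * φ b
          ∂(Measure.pi fun _ : ι => haarProbability (Matrix.specialUnitaryGroup (Fin 2) ℂ)))
    (z : Lp ℝ 2 (Measure.pi fun _ : ι => haarProbability (Matrix.specialUnitaryGroup (Fin 2) ℂ)))
    (S : Finset (ι → ℕ)) : ∑ ν ∈ S, ‖P ν z‖ ^ 2 ≤ ‖z‖ ^ 2 := by
  have h := SU2Links.sum_integral_charProj_sq_le (ι := ι) S (Lp.memLp z)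
  have hzz : ‖z‖ ^ 2 = ∫ a, (z : (ι → Matrix.specialUnitaryGroup (Fin 2) ℂ) → ℝ) a ^ 2
      ∂(Measure.pi fun _ : ι => haarProbability (Matrix.specialUnitaryGroup (Fin 2) ℂ)) := by
    rw [← real_inner_self_eq_norm_sq, inner_eq_integral]
    exact integral_congr_ae (Eventually.of_forall fun a => by simp only [sq])
  rw [hzz]
  refine le_trans (le_of_eq (Finset.sum_congr rfl fun ν _ => norm_sq_charProjOp ν (hP ν) z)) h

end CharProjOp

end KWeightTailOperator

end Summit.Ventures.YMGap.FlowData
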